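import Mathlib
import Summits.NavierStokesRegularity.NavierStokesRegularity.Theorems.EulerZoomLiouvillePowerGaugeEulerLiouvilleSelfSimilarTopBadNodeArcDynamics
import HarnessLib.Audit

/-!
# Rung C1 of the crux `EulerZoomLiouville.PowerGaugeEulerLiouville`: cone and decay lemmas WITH A FORCING FLOOR
# (real-variable inputs for the exit analysis at a singular top bad node)

Route №10 `EulerZoomLiouville` (NavierStokesRegularity), crux E = stmt-NavierStokesRegularity-19832,
tenure rung C1 (exactly self-similar members), registered residue `stub_selfSimilarExtremal`.
Thirteenth file of the NODAL-CONTINUUM line (lineage ns-typeII-p1, gen 7).  After `false_of_topBadNode_of_arc`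
the classical survivor's top bad node `z♭` is a singular point of the stagnation set along its kernel line; in
the coordinates of the zero curve `W` through `z♭` (lineage ns-typeII-p2, `NoDrift.exists_zeroCurve_of_corankOne`)
the transversal part `ξ` of a backward trajectory obeys `ξ' = −Aξ + O(ρ|ξ|) + (forcing of size ≤ Φ^{1/2})`, the
forcing coming from the drift `φ` along `W` (`W` is not flow-invariant).  This file records the two scalar
comparison lemmas that survive an ABSOLUTE forcing floor `Φ ≥ 0`, with all hypotheses localised to `[0, t₁]`
(evidence note TOPNODE-CLOSURE-PLAN on the crux item, step F3):

* `shiftedCone_invariant_of_ineq` — with `p' ≤ −μp + c(p+m) + Φ`, `m' ≥ μm − c(p+m) − Φ` on `[0, t₁]`,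
  `c(1+K) ≤ μ/4`, `K ≥ 1`, `B = 4(1+K)Φ/μ`: the shifted cone `{m ≥ Kp + B}`, once entered STRICTLY, is kept up
  to `t₁` (on its boundary `(m − Kp)' ≥ μB/2 − (1+K)Φ > 0`);
* `decay_to_floor_of_ineq` — outside the shifted cone (`m < Kp + B` on `[0, t₁]`): `p(t) ≤ p(0)e^{−μt/2} + F`
  with the floor level `F = 2(cB + Φ)/μ` (barrier for `p − F` against `e^{−μt/2}p(0)`).

WHAT THIS IS NOT: not NS, not E — elementary real analysis; the profile-level no-exit lemma is NOT here.
References: A. Katok, B. Hasselblatt (1995), §6.2 (cone criterion) [KatokHasselblatt1995].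
-/

noncomputable section

-- flat `Theorems/<Route><Decl>…` files of one crux share the namespace of the crux (tree convention)
set_option linter.dupNamespace false

open Set Filter Topology Metric Function

namespace Summit.NavierStokesRegularity.NavierStokesRegularity.Theorems.PowerGaugeEulerLiouville.NodalContinuum

/-- **Shifted cone invariance under a forcing floor.**  Real functions `p, m` on `[0, t₁]` with derivatives
`pd, md` (within `[0, t₁]`) satisfying `pd ≤ −μp + c(p+m) + Φ`, `md ≥ μm − c(p+m) − Φ`, where `μ > 0`, `K ≥ 1`,
`c(1+K) ≤ μ/4`, `Φ ≥ 0`, `p ≥ 0`, `p + m > 0`; `B := 4(1+K)Φ/μ`.  If `Kp + B ≤ m` at some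
`t_c ∈ [0, t₁]` then `Kp + B ≤ m` at `t₁`. [cite: KatokHasselblatt1995, §6.2 (cone criterion, with forcing)] -/
theorem shiftedCone_invariant_of_ineq {p m pd md : ℝ → ℝ} {K μ c Φ tc t₁ : ℝ} (hK1 : 1 ≤ K) (hμ : 0 < μ)
    (hcK : c * (1 + K) ≤ μ / 4) (hΦ : 0 ≤ Φ)
    (hp' : ∀ t ∈ Icc 0 t₁, HasDerivAt p (pd t) t) (hm' : ∀ t ∈ Icc 0 t₁, HasDerivAt m (md t) t)
    (hpnn : ∀ t ∈ Icc 0 t₁, 0 ≤ p t) (hpos : ∀ t ∈ Icc 0 t₁, 0 < p t + m t)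
    (hpd : ∀ t ∈ Icc 0 t₁, pd t ≤ -μ * p t + c * (p t + m t) + Φ)
    (hmd : ∀ t ∈ Icc 0 t₁, μ * m t - c * (p t + m t) - Φ ≤ md t)
    (htc : tc ∈ Icc 0 t₁) (hcone0 : K * p tc + 4 * (1 + K) * Φ / μ ≤ m tc) :
    K * p t₁ + 4 * (1 + K) * Φ / μ ≤ m t₁ := by
  have hKpos : 0 < K := by linarith
  set B : ℝ := 4 * (1 + K) * Φ / μ with hB
  have hBnn : 0 ≤ B := by positivity
  have hsub : Icc tc t₁ ⊆ Icc 0 t₁ := Icc_subset_Icc htc.1 le_rfl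
  -- barrier for `f = Kp + B - m` with a strictly increasing boundary `σ(t - tc)`? use the constant boundary
  -- and a strict derivative estimate `f' < 0` on `{f = 0}`.
  have key := image_le_of_deriv_right_lt_deriv_boundary' (f := fun t => K * p t + B - m t)
    (f' := fun t => K * pd t - md t) (a := tc) (b := t₁)
    (fun s hs => ((((hp' s (hsub hs)).const_mul K).add_const B).sub
      (hm' s (hsub hs))).continuousAt.continuousWithinAt)
    (fun s hs => ((((hp' s (hsub ⟨hs.1, hs.2.le⟩)).const_mul K).add_const B).sub
      (hm' s (hsub ⟨hs.1, hs.2.le⟩))).hasDerivWithinAt)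
    (B := fun _ => 0) (B' := fun _ => 0) (by linarith only [hcone0]) continuousOn_const
    (fun s _ => hasDerivWithinAt_const _ _ _) ?_ (right_mem_Icc.2 htc.2)
  · linarith only [key]
  intro s hs hfs
  have hs' : s ∈ Icc 0 t₁ := hsub ⟨hs.1, hs.2.le⟩
  have hms : m s = K * p s + B := by linarith only [hfs]
  have h1 := hpd s hs'
  have h2 := hmd s hs'
  have hps := hpnn s hs'
  rw [hms] at h1 h2
  -- `K pd - md ≤ -2Kμ p - μB + c(1+K)((1+K)p + B) + (1+K)Φ < 0`
  have h1K := mul_le_mul_of_nonneg_left h1 hKpos.le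
  have hcK' : c * (1 + K) * ((1 + K) * p s + B) ≤ μ / 4 * ((1 + K) * p s + B) :=
    mul_le_mul_of_nonneg_right hcK (by positivity)
  have hBμ : μ * B = 4 * (1 + K) * Φ := by rw [hB]; field_simp
  have hμp : 0 ≤ μ * p s := mul_nonneg hμ.le hps
  have hq : 0 < μ * p s + 4 * Φ := by
    have h3 := hpos s hs'
    rw [hms] at h3
    by_contra hle
    push Not at hle
    have hp0 : p s = 0 := by nlinarith only [hle, hμp, hΦ, hμ, hps]
    have hΦ0 : Φ = 0 := by nlinarith only [hle, hμp, hΦ]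
    have hB0 : B = 0 := by rw [hB, hΦ0]; simp
    rw [hp0, hB0] at h3
    linarith only [h3]
  have h7 : 3 / 2 * (μ * p s) ≤ (2 * K - (1 + K) / 4) * (μ * p s) :=
    mul_le_mul_of_nonneg_right (by linarith only [hK1]) hμp
  have h8 : 4 * Φ ≤ 2 * (1 + K) * Φ := by nlinarith only [hK1, hΦ]
  show K * pd s - md s < 0
  linarith only [h1K, h2, hcK', hBμ, hq, h7, h8, hμp]

/-- **Decay to the floor outside the shifted cone.**  With `p, m, pd` as above, `pd ≤ −μp + c(p+m) + Φ` and
`m < Kp + B` on `[0, t₁]` (`B ≥ 0`, `c(1+K) ≤ μ/2`): `p(t) ≤ p(0)e^{−μt/2} + F` on `[0, t₁]` with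
`F = 2(cB + Φ)/μ`. [folklore] -/
theorem decay_to_floor_of_ineq {p m pd : ℝ → ℝ} {K μ c Φ B t₁ : ℝ} (hμ : 0 < μ) (hc0 : 0 ≤ c)
    (hcK : c * (1 + K) ≤ μ / 2) (hΦ : 0 ≤ Φ) (hB : 0 ≤ B)
    (hp' : ∀ t ∈ Icc 0 t₁, HasDerivAt p (pd t) t) (hpnn : ∀ t ∈ Icc 0 t₁, 0 ≤ p t)
    (hpd : ∀ t ∈ Icc 0 t₁, pd t ≤ -μ * p t + c * (p t + m t) + Φ)
    (hcone : ∀ t ∈ Icc 0 t₁, m t < K * p t + B) {t : ℝ} (ht : t ∈ Icc 0 t₁) :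
    p t ≤ p 0 * Real.exp (-(μ / 2) * t) + 2 * (c * B + Φ) / μ := by
  set F : ℝ := 2 * (c * B + Φ) / μ with hF
  have hFnn : 0 ≤ F := by positivity
  have hμF : μ / 2 * F = c * B + Φ := by rw [hF]; field_simp
  -- `pd ≤ -(μ/2) p + (cB + Φ)` on `[0, t₁]`
  have hpdec : ∀ s ∈ Icc 0 t₁, pd s ≤ -(μ / 2) * p s + (c * B + Φ) := by
    intro s hs
    have h1 := hpd s hs
    have h2 : c * (p s + m s) ≤ c * ((1 + K) * p s + B) :=
      mul_le_mul_of_nonneg_left (by linarith only [hcone s hs]) hc0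
    have h3 : c * (1 + K) * p s ≤ μ / 2 * p s := mul_le_mul_of_nonneg_right hcK (hpnn s hs)
    nlinarith only [h1, h2, h3]
  -- comparison with the solution `G(t) = (p 0 - F) e^{-μt/2} + F` of the linear equation, via `e^{μt/2}(p - F)`
  set G : ℝ → ℝ := fun s => Real.exp (μ / 2 * s) * (p s - F) with hGdef
  have hG' : ∀ s ∈ Icc 0 t₁, HasDerivAt G (Real.exp (μ / 2 * s) * (μ / 2 * (p s - F) + pd s)) s := by
    intro s hs
    have he' : HasDerivAt (fun s => Real.exp (μ / 2 * s)) (Real.exp (μ / 2 * s) * (μ / 2 * 1)) s :=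
      ((hasDerivAt_id s).const_mul (μ / 2)).exp
    exact (he'.mul ((hp' s hs).sub_const F)).congr_deriv (by ring)
  have hGanti : AntitoneOn G (Icc 0 t₁) := by
    refine antitoneOn_of_hasDerivWithinAt_nonpos (convex_Icc 0 t₁)
      (fun s hs => (hG' s hs).continuousAt.continuousWithinAt)
      (fun s hs => (hG' s (interior_subset hs)).hasDerivWithinAt) ?_
    intro s hs
    rw [interior_Icc] at hs
    have := hpdec s ⟨hs.1.le, hs.2.le⟩
    exact mul_nonpos_iff.2 (Or.inl ⟨(Real.exp_pos _).le, by linarith only [this, hμF]⟩)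
  have h1 : G t ≤ G 0 := hGanti (left_mem_Icc.2 (ht.1.trans ht.2)) ht ht.1
  simp only [hGdef, mul_zero, Real.exp_zero, one_mul] at h1
  -- unfold: `e^{μt/2}(p t - F) ≤ p 0 - F`
  have hexp : Real.exp (-(μ / 2) * t) * Real.exp (μ / 2 * t) = 1 := by
    rw [← Real.exp_add]; simp
  have h2 : p t - F ≤ (p 0 - F) * Real.exp (-(μ / 2) * t) := by
    have := mul_le_mul_of_nonneg_right h1 (Real.exp_pos (-(μ / 2) * t)).le
    calc p t - F = Real.exp (μ / 2 * t) * (p t - F) * Real.exp (-(μ / 2) * t) := by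
          rw [mul_comm (Real.exp _) (p t - F), mul_assoc, mul_comm (Real.exp (μ / 2 * t)), hexp, mul_one]
      _ ≤ (p 0 - F) * Real.exp (-(μ / 2) * t) := this
  have h3 : (p 0 - F) * Real.exp (-(μ / 2) * t) ≤ p 0 * Real.exp (-(μ / 2) * t) := by
    have := Real.exp_pos (-(μ / 2) * t)
    nlinarith only [this, hFnn]
  show p t ≤ p 0 * Real.exp (-(μ / 2) * t) + F
  linarith only [h2, h3]

end Summit.NavierStokesRegularity.NavierStokesRegularity.Theorems.PowerGaugeEulerLiouville.NodalContinuum
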